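import Mathlib
import Literature.Computability.Complexity.ExtMonotoneGates
import Literature.Computability.Complexity.CliqueApproximatorsWide

/-!
# drefute side-product: `stub_termCollapse` PROVED (candidate proof for the lead, not a refutation)

refuter-drefute-stmt-PneNP-10681-0, 2026-08-16. While attacking the stub set of line
`dnf-invariant-wide-gates-see-small-cliques` (crux stmt-PneNP-10681) the collapse stub turned out to be
true AND short; this file proves it in full (`lean check` rc 0, 0 sorry, 0 warnings):

* `termCollapse_perm`  — PERM ∘ OR ⊆ PERM at the same point budget (`σ'_{(i,X)} := σ_i`, same `τ`, `d`);
* `le_rank_symbolicMatrix_fibre_iff` — generic rank is invariant under pulling the pencil back along the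
  fibres of any `π : Fin N → Fin n` when the switched-on sets correspond (`ψ : X_i ↦ Σ_{π a = i} X_a`,
  `kill_w ∘ ψ` factors through `kill_v` and has a left inverse on `F[X_i : v_i = 1]`);
* `termCollapse_grank` — GRANK ∘ OR ⊆ GRANK at the same dimension, field and threshold;
* `termCollapse` — literally the statement of `TermCollapse` / `stub_termCollapse`.

`atomB`, `acceptsB`, `IsTermGate` are VERBATIM copies of the skeleton's §2 definitions (the Lines file is not
an importable module); inside the skeleton the three theorems paste into §5 unchanged and
`stub_termCollapse := termCollapse` closes the stub.
-/

set_option linter.dupNamespace false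

namespace Summit.PneNP.PneNP.Cruxes.LinAlgGateBlind.DnfInvariantWideGatesSeeSmallCliques.Drefute2

open Finset Literature.Computability.Complexity Razborov

noncomputable section

section GRankFibre

variable {F : Type*} [Field F] {n N d : ℕ}

/-- The substitution `X_i ↦ Σ_{a : π a = i} X_a`. -/
def fibreSum (π : Fin N → Fin n) : MvPolynomial (Fin n) F →ₐ[F] MvPolynomial (Fin N) F :=
  MvPolynomial.aeval fun i => ∑ a : Fin N, if π a = i then MvPolynomial.X a else 0

@[simp] theorem fibreSum_X (π : Fin N → Fin n) (i : Fin n) :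
    fibreSum (F := F) π (MvPolynomial.X i) = ∑ a : Fin N, if π a = i then MvPolynomial.X a else 0 := by
  simp [fibreSum]

/-- The generic symbolic matrix of the pulled-back data is the `fibreSum`-image of the old one. -/
theorem symbolicPolyMatrix_pullback (K₀ : Matrix (Fin d) (Fin d) F)
    (K : Fin n → Matrix (Fin d) (Fin d) F) (π : Fin N → Fin n) :
    symbolicPolyMatrix K₀ (fun a => K (π a)) = (symbolicPolyMatrix K₀ K).map (fibreSum π) := by
  refine Matrix.ext fun j k => ?_
  simp only [symbolicPolyMatrix, Matrix.add_apply, Matrix.map_apply, Matrix.sum_apply,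
    Matrix.smul_apply, smul_eq_mul, map_add, map_sum, map_mul, MvPolynomial.algHom_C, fibreSum_X,
    MvPolynomial.algebraMap_eq]
  refine congrArg (MvPolynomial.C (K₀ j k) + ·) ?_
  symm
  calc ∑ i, (∑ a, if π a = i then (MvPolynomial.X a : MvPolynomial (Fin N) F) else 0) *
          MvPolynomial.C (K i j k)
      = ∑ i, ∑ a, (if π a = i then (MvPolynomial.X a : MvPolynomial (Fin N) F) else 0) *
          MvPolynomial.C (K i j k) :=
        Finset.sum_congr rfl fun i _ => Finset.sum_mul _ _ _
    _ = ∑ a, ∑ i, (if π a = i then (MvPolynomial.X a : MvPolynomial (Fin N) F) else 0) *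
          MvPolynomial.C (K i j k) := Finset.sum_comm
    _ = ∑ a, (MvPolynomial.X a : MvPolynomial (Fin N) F) * MvPolynomial.C (K (π a) j k) := by
        refine Finset.sum_congr rfl fun a _ => ?_
        rw [Finset.sum_eq_single (π a), if_pos rfl]
        · intro i _ hi
          rw [if_neg (Ne.symm hi), zero_mul]
        · intro h
          exact absurd (Finset.mem_univ _) h

/-- **Generic rank is invariant under pulling the pencil back along fibres.** -/
theorem le_rank_symbolicMatrix_fibre_iff (K₀ : Matrix (Fin d) (Fin d) F)
    (K : Fin n → Matrix (Fin d) (Fin d) F) (π : Fin N → Fin n) (θ : ℕ) {v : Fin n → Bool}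
    {w : Fin N → Bool} (hvw : ∀ i, v i = true ↔ ∃ a, π a = i ∧ w a = true) :
    θ ≤ (symbolicMatrix K₀ K v).rank ↔ θ ≤ (symbolicMatrix K₀ (fun a => K (π a)) w).rank := by
  classical
  rw [Literature.LinearAlgebra.Matrix.le_rank_iff_exists_det_submatrix_ne_zero,
    Literature.LinearAlgebra.Matrix.le_rank_iff_exists_det_submatrix_ne_zero]
  refine exists_congr fun r => exists_congr fun c => not_congr ?_
  rw [det_submatrix_symbolicMatrix_eq_zero_iff, det_submatrix_symbolicMatrix_eq_zero_iff,
    symbolicPolyMatrix_pullback K₀ K π, Matrix.submatrix_map, ← AlgHom.mapMatrix_apply,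
    ← AlgHom.map_det]
  set P := ((symbolicPolyMatrix K₀ K).submatrix r c).det with hP
  -- `ρ = kill_w ∘ ψ` factors through `kill_v`
  let ρ : MvPolynomial (Fin n) F →ₐ[F] MvPolynomial (Fin N) F := (killVars w).comp (fibreSum π)
  have hρX_off : ∀ i, v i = false → ρ (MvPolynomial.X i) = 0 := by
    intro i hi
    show killVars w (fibreSum π (MvPolynomial.X i)) = 0
    rw [fibreSum_X, map_sum]
    refine Finset.sum_eq_zero fun a _ => ?_
    by_cases h1 : π a = i
    · rw [if_pos h1, killVars_X]
      by_cases h2 : w a = true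
      · have := (hvw i).2 ⟨a, h1, h2⟩
        rw [hi] at this
        exact absurd this Bool.false_ne_true
      · rw [if_neg h2]
    · rw [if_neg h1, map_zero]
  have h1 : ρ.comp (killVars v) = ρ := by
    refine MvPolynomial.algHom_ext fun i => ?_
    rw [AlgHom.comp_apply, killVars_X]
    cases hvi : v i
    · rw [if_neg Bool.false_ne_true, map_zero]
      exact (hρX_off i hvi).symm
    · rw [if_pos rfl]
  -- a left inverse of `ρ` on the polynomials in the switched-on old variables
  let ch : ∀ i, v i = true → Fin N := fun i h => Classical.choose ((hvw i).1 h)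
  have ch_spec : ∀ i (h : v i = true), π (ch i h) = i ∧ w (ch i h) = true :=
    fun i h => Classical.choose_spec ((hvw i).1 h)
  have ch_congr : ∀ i j (hi : v i = true) (hj : v j = true), j = i → ch j hj = ch i hi := by
    rintro i j hi hj rfl
    rfl
  let lam : MvPolynomial (Fin N) F →ₐ[F] MvPolynomial (Fin n) F :=
    MvPolynomial.aeval fun a => if ∃ h : v (π a) = true, a = ch (π a) h then
      MvPolynomial.X (π a) else 0
  have h2 : (lam.comp ρ).comp (killVars v) = killVars v := by
    refine MvPolynomial.algHom_ext fun i => ?_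
    rw [AlgHom.comp_apply, AlgHom.comp_apply, killVars_X]
    cases hvi : v i
    · simp
    · rw [if_pos rfl]
      show lam (killVars w (fibreSum π (MvPolynomial.X i))) = MvPolynomial.X i
      rw [fibreSum_X, map_sum, map_sum, Finset.sum_eq_single (ch i hvi)]
      · -- the chosen section contributes `X i`
        obtain ⟨hπ, hw⟩ := ch_spec i hvi
        rw [if_pos hπ, killVars_X, if_pos hw]
        simp only [lam, MvPolynomial.aeval_X]
        have hvπ : v (π (ch i hvi)) = true := by rw [hπ]; exact hvi
        rw [if_pos ⟨hvπ, (ch_congr i _ hvi hvπ hπ).symm⟩, hπ]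
      · -- every other `a` contributes `0`
        intro a _ ha
        by_cases hπ : π a = i
        · rw [if_pos hπ, killVars_X]
          by_cases hw : w a = true
          · rw [if_pos hw]
            simp only [lam, MvPolynomial.aeval_X]
            rw [if_neg]
            rintro ⟨h, hach⟩
            exact ha (hach.trans (ch_congr i _ hvi h hπ))
          · rw [if_neg hw, map_zero]
        · rw [if_neg hπ, map_zero, map_zero]
      · intro h
        exact absurd (Finset.mem_univ _) h
  constructor
  · intro h0
    have := congrArg ρ h0
    rw [map_zero, ← AlgHom.comp_apply, h1] at this
    exact this
  · intro h0
    have hρ0 : ρ (killVars v P) = 0 := by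
      rw [← AlgHom.comp_apply, h1]
      exact h0
    have := congrArg lam hρ0
    rw [map_zero, ← AlgHom.comp_apply, ← AlgHom.comp_apply, h2] at this
    exact this

end GRankFibre

open Classical in
/-- (copy of the skeleton's `atomB`) -/
def atomB {m : ℕ} (X : Finset (Fin m)) (x : KEdge m → Bool) : Bool := decide (CliquePresent X x)

open Classical in
/-- (copy of the skeleton's `acceptsB`) -/
def acceptsB {m : ℕ} (𝒜 : Finset (Finset (Fin m))) (x : KEdge m → Bool) : Bool := decide (Accepts 𝒜 x)

/-- (copy of the skeleton's `IsTermGate`) -/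
def IsTermGate (m : ℕ) (P : GateFn → Prop) (l : ℕ) (O : (KEdge m → Bool) → Bool) : Prop :=
  ∃ g : GateFn, P g ∧ ∃ X : Fin g.1 → Finset (Fin m),
    (∀ a, X a ∈ smallSets (Fin m) l) ∧ ∀ x, O x = g.2 (fun a => atomB (X a) x)

open Classical in
/-- **PERM ∘ OR ⊆ PERM at the same point budget.** A permutation-membership gate of parameter `s` fed with the
small-clique DNFs `⌈A_i⌉`, `A_i ⊆ 𝒱(l)`, is one permutation-membership gate of parameter `s` over the atoms
`⌈X⌉`, `X ∈ A_i`: index the new inputs by the pairs `(i, X)`, `X ∈ A_i`, give the pair the generator `σ_i`, keep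
`τ` and `d`; the selected generator SETS coincide. -/
theorem termCollapse_perm (m s l : ℕ) (g : GateFn) (A : Fin g.1 → Finset (Finset (Fin m)))
    (hA : ∀ i, A i ⊆ smallSets (Fin m) l) (hg : IsPermGate s g) :
    IsTermGate m (IsPermGate s) l fun x => g.2 fun i => acceptsB (A i) x := by
  obtain ⟨d, hd, σ, τ, hστ⟩ := hg
  -- new input index set: pairs `(i, X)` with `X ∈ A i`
  let I : Type := Σ i : Fin g.1, ↥(A i)
  let N : ℕ := Fintype.card I
  let e : I ≃ Fin N := Fintype.equivFin I
  let σ' : Fin N → Equiv.Perm (Fin d) := fun a => σ (e.symm a).1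
  let X : Fin N → Finset (Fin m) := fun a => ((e.symm a).2 : Finset (Fin m))
  let g' : GateFn := ⟨N, fun w => decide (τ ∈ Subgroup.closure (σ' '' {a | w a = true}))⟩
  refine ⟨g', ⟨d, hd, σ', τ, fun w => ?_⟩, X, fun a => hA _ (e.symm a).2.2, fun x => ?_⟩
  · show decide _ = true ↔ _
    rw [decide_eq_true_iff]
  · -- the selected generator sets coincide
    have hset : σ '' {i | acceptsB (A i) x = true} = σ' '' {a | atomB (X a) x = true} := by
      ext π
      simp only [Set.mem_image, Set.mem_setOf_eq]
      constructor
      · rintro ⟨i, hi, rfl⟩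
        have hacc : Accepts (A i) x := by simpa [acceptsB] using hi
        obtain ⟨W, hW, hWx⟩ := hacc
        refine ⟨e ⟨i, ⟨W, hW⟩⟩, ?_, ?_⟩
        · have hx : X (e ⟨i, ⟨W, hW⟩⟩) = W := by
            show ((e.symm (e ⟨i, ⟨W, hW⟩⟩)).2 : Finset (Fin m)) = W
            rw [Equiv.symm_apply_apply]
          simpa [atomB, hx] using hWx
        · simp [σ']
      · rintro ⟨a, ha, rfl⟩
        refine ⟨(e.symm a).1, ?_, rfl⟩
        have hWx : CliquePresent (X a) x := by simpa [atomB] using ha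
        have hacc : Accepts (A (e.symm a).1) x := ⟨X a, (e.symm a).2.2, hWx⟩
        simpa [acceptsB] using hacc
    show g.2 (fun i => acceptsB (A i) x) = decide (τ ∈ Subgroup.closure (σ' '' {a | atomB (X a) x = true}))
    rw [Bool.eq_iff_iff, hστ, decide_eq_true_iff, hset]


/-- **GRANK ∘ OR ⊆ GRANK at the same dimension.** A generic-rank threshold gate of parameter `s` fed with the
small-clique DNFs `⌈A_i⌉`, `A_i ⊆ 𝒱(l)`, is one generic-rank threshold gate of parameter `s` (same field,
`K₀`, `θ`, `d`) over the atoms `⌈X⌉`, `X ∈ A_i`, with `K'_{(i,X)} := K_i`. -/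
theorem termCollapse_grank (m s l : ℕ) (g : GateFn) (A : Fin g.1 → Finset (Finset (Fin m)))
    (hA : ∀ i, A i ⊆ smallSets (Fin m) l) (hg : IsGRankGate s g) :
    IsTermGate m (IsGRankGate s) l fun x => g.2 fun i => acceptsB (A i) x := by
  obtain ⟨F, instF, d, θ, hd, K₀, K, hK⟩ := hg
  let I : Type := Σ i : Fin g.1, ↥(A i)
  let N : ℕ := Fintype.card I
  let e : I ≃ Fin N := Fintype.equivFin I
  let π : Fin N → Fin g.1 := fun a => (e.symm a).1
  let X : Fin N → Finset (Fin m) := fun a => ((e.symm a).2 : Finset (Fin m))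
  let g' : GateFn := ⟨N, fun w => decide (θ ≤ (symbolicMatrix K₀ (fun a => K (π a)) w).rank)⟩
  refine ⟨g', ⟨F, instF, d, θ, hd, K₀, fun a => K (π a), fun w => ?_⟩, X,
    fun a => hA _ (e.symm a).2.2, fun x => ?_⟩
  · show decide _ = true ↔ _
    rw [decide_eq_true_iff]
  · show g.2 (fun i => acceptsB (A i) x) =
      decide (θ ≤ (symbolicMatrix K₀ (fun a => K (π a)) fun a => atomB (X a) x).rank)
    rw [Bool.eq_iff_iff, hK, decide_eq_true_iff]
    refine le_rank_symbolicMatrix_fibre_iff K₀ K π θ fun i => ?_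
    constructor
    · intro hi
      have hacc : Accepts (A i) x := by simpa [acceptsB] using hi
      obtain ⟨W, hW, hWx⟩ := hacc
      refine ⟨e ⟨i, ⟨W, hW⟩⟩, ?_, ?_⟩
      · show (e.symm (e ⟨i, ⟨W, hW⟩⟩)).1 = i
        rw [Equiv.symm_apply_apply]
      · have hx : X (e ⟨i, ⟨W, hW⟩⟩) = W := by
          show ((e.symm (e ⟨i, ⟨W, hW⟩⟩)).2 : Finset (Fin m)) = W
          rw [Equiv.symm_apply_apply]
        simpa [atomB, hx] using hWx
    · rintro ⟨a, rfl, ha⟩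
      have hWx : CliquePresent (X a) x := by simpa [atomB] using ha
      have hacc : Accepts (A (π a)) x := ⟨X a, (e.symm a).2.2, hWx⟩
      simpa [acceptsB] using hacc

/-- **`TermCollapse` (= `stub_termCollapse` of the skeleton), proved.** -/
theorem termCollapse :
    ∀ (m s l : ℕ) (g : GateFn) (A : Fin g.1 → Finset (Finset (Fin m))),
      (∀ i, A i ⊆ smallSets (Fin m) l) →
        (IsPermGate s g → IsTermGate m (IsPermGate s) l fun x => g.2 fun i => acceptsB (A i) x) ∧
        (IsGRankGate s g → IsTermGate m (IsGRankGate s) l fun x => g.2 fun i => acceptsB (A i) x) :=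
  fun m s l g A hA => ⟨termCollapse_perm m s l g A hA, termCollapse_grank m s l g A hA⟩

end

end Summit.PneNP.PneNP.Cruxes.LinAlgGateBlind.DnfInvariantWideGatesSeeSmallCliques.Drefute2
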